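import Mathlib.Data.Real.Basic
import Mathlib.Tactic.Linarith
import Mathlib.Tactic.Ring
import Summits.CriticalPhenomena.PercolationContinuityZ3.Theorems.PercNearOneGluingNoHeavyLowerTailThreePointLBSwitchingCertificate
import HarnessLib

/-!
# `NoHeavyLowerTail` (stmt-CriticalPhenomena-4575) — HYBRID / GROUP three-point lower bound by four switchings, III:
# the finite certificate check (12 atoms, 8 implications) and the seven-atom cubic identity

Support file (prover prim-cert-2 gen 9; `--supports stmt-CriticalPhenomena-4575`).  No named facts, no sorries; graph-free.

The two finite ingredients of prim-ineq-gen-8's THEOREM-HYBRID-3PTLB (2026-08-19) that do not mention graphs (companion of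
`…ThreePointLBSwitchingCertificate`, whose `pind`/`bI` it reuses):
* `hcertB_nonpos` / `hcertP_nonpos` — **Lemma 2 (pointwise), abstract form.**  After the sealed-island facts F1′/F2′ rewrite every
  membership of the outputs of the four group switchings, the pointwise sum `S = λ₀ + Σ λᵢ∘Φᵢ` is a signed sum of seven indicator
  monomials in TWELVE atoms: `xBA = [P₁ ~_X P₃′]`, `xBc = [P₁ ~_X c]`, `xAc = [P₃ ~_X c]`, `xApc = [P₃′ ~_X c]`, `yBc = [P₁ ~_Y c]`,
  `yBcA = [P₁ ~ c by Y-pairs avoiding gcl X P₃′]`, `zAc = [P₃ ~_Z c]`, `zAcB = [P₃ ~ c by Z-pairs avoiding gcl X P₁]`, `m3b, m3a` (the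
  connections `c ~ P₁`, `c ~ P₃` in the two-region output of `Φ₃`), `m4BA, m4Bc` (`P₁ ~ P₃′`, `P₁ ~ c` in the two-region output of `Φ₄`);
  the group-cluster facts supply EIGHT implications (`P₃ ⊆ P₃′`; transitivity through the vertex `c`; two monotonicities; F4′(ii) twice;
  F4′(i) twice).  `hcertB_nonpos`: on all `2¹²` Boolean patterns satisfying them the sum is `≤ 0` (`decide`); `hcertP_nonpos`: for
  propositions.  (Machine cross-check of the abstraction: prim-cert-2 work/hyb/abstract12b.py, 638 feasible patterns, max 0; all eight
  implications are needed.)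
* `hyb_identity` — **IDENTITY (I)**: with the seven atoms `q, u_a, u_b, u_c, t, n₁, n₂` of the algebra of `A₁ = {P₁≁c}, A₂ = {c≁P₃},
  A₃ = {P₁≁P₃′}` (`A₁ᶜA₂ᶜA₃ = ∅`) summing to `1`, the sum of the seven expectations equals `−E₃(A₁,A₂,A₃)` (`ring`; 41 monomials).
-/

noncomputable section

namespace Summit.CriticalPhenomena.PercolationContinuityZ3.Theorems

namespace HybridThreePointLB

open ThreePointLB

/-! ### The finite certificate check -/

/-- The pointwise hybrid certificate as a function of the 12 Boolean atoms (parenthesised as `simp` produces it). [this work] -/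
def hcertB (xBA xBc xAc xApc yBc yBcA zAc zAcB m3a m3b m4BA m4Bc : Bool) : ℤ :=
  bI ((xBc && !xBA) && (!yBc && zAc))
  + bI ((xAc && !xBA) && (yBc && !zAc))
  - bI ((!xBA && (!xBc && !xAc)) && (!yBc && !zAc))
  - bI ((!xBA && (!((xApc && xBc) || (!xApc && yBcA)) && !xAc)) && zAc)
  - bI (yBc && (!xBA && (!xBc && !((xBc && xAc) || (!xBc && zAcB)))))
  + bI ((((xApc && xBc) || (!xApc && yBcA)) && !xBA) && (!m3b && !m3a))
  + bI ((!m4BA && !m4Bc) && (!xBc && !xAc))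

set_option synthInstance.maxHeartbeats 200000 in
set_option synthInstance.maxSize 2048 in
/-- **The hybrid certificate is pointwise nonpositive** on every Boolean pattern of the atoms compatible with the eight implications
supplied by the group-cluster facts (`2¹²` cases, by `decide`). [this work] -/
theorem hcertB_nonpos : ∀ xBA xBc xAc xApc yBc yBcA zAc zAcB m3a m3b m4BA m4Bc : Bool,
    (xAc = true → xApc = true) → (xBc = true → xApc = true → xBA = true) →
    (yBcA = true → yBc = true) → (zAcB = true → zAc = true) →
    (zAcB = true → m3a = true) → (xBc = true → xBA = false → m3b = true) →
    (yBcA = true → m4Bc = true) → (xBA = true → xBc = false → m4BA = true) →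
    hcertB xBA xBc xAc xApc yBc yBcA zAc zAcB m3a m3b m4BA m4Bc ≤ 0 := by
  decide +kernel

/-- **Pointwise lemma, propositional form** (THEOREM-HYBRID-3PTLB, Lemma 2 with the cluster facts abstracted): for any twelve
propositions satisfying the eight implications, the certificate expression is `≤ 0`. [this work] -/
theorem hcertP_nonpos (xBA xBc xAc xApc yBc yBcA zAc zAcB m3a m3b m4BA m4Bc : Prop)
    (h1 : xAc → xApc) (h2 : xBc → xApc → xBA) (h4 : yBcA → yBc) (h5 : zAcB → zAc) (h6 : zAcB → m3a)
    (h7 : xBc → ¬xBA → m3b) (h8 : yBcA → m4Bc) (h9 : xBA → ¬xBc → m4BA) :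
    pind ((xBc ∧ ¬xBA) ∧ ¬yBc ∧ zAc)
    + pind ((xAc ∧ ¬xBA) ∧ yBc ∧ ¬zAc)
    - pind ((¬xBA ∧ ¬xBc ∧ ¬xAc) ∧ ¬yBc ∧ ¬zAc)
    - pind ((¬xBA ∧ ¬(xApc ∧ xBc ∨ ¬xApc ∧ yBcA) ∧ ¬xAc) ∧ zAc)
    - pind (yBc ∧ ¬xBA ∧ ¬xBc ∧ ¬(xBc ∧ xAc ∨ ¬xBc ∧ zAcB))
    + pind (((xApc ∧ xBc ∨ ¬xApc ∧ yBcA) ∧ ¬xBA) ∧ ¬m3b ∧ ¬m3a)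
    + pind ((¬m4BA ∧ ¬m4Bc) ∧ ¬xBc ∧ ¬xAc) ≤ 0 := by
  classical
  have key := hcertB_nonpos (decide xBA) (decide xBc) (decide xAc) (decide xApc) (decide yBc) (decide yBcA) (decide zAc)
      (decide zAcB) (decide m3a) (decide m3b) (decide m4BA) (decide m4Bc)
      (by simpa only [decide_eq_true_eq] using h1) (by simpa only [decide_eq_true_eq] using h2)
      (by simpa only [decide_eq_true_eq] using h4) (by simpa only [decide_eq_true_eq] using h5)
      (by simpa only [decide_eq_true_eq] using h6)
      (by simpa only [decide_eq_true_eq, decide_eq_false_iff_not] using h7)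
      (by simpa only [decide_eq_true_eq] using h8)
      (by simpa only [decide_eq_true_eq, decide_eq_false_iff_not] using h9)
  rw [pind_eq_bI, pind_eq_bI, pind_eq_bI, pind_eq_bI, pind_eq_bI, pind_eq_bI, pind_eq_bI]
  simp only [Bool.decide_and, Bool.decide_or, decide_not]
  unfold hcertB at key
  exact_mod_cast key

/-! ### The seven-atom cubic identity -/

/-- **IDENTITY (I)** of THEOREM-HYBRID-3PTLB as a polynomial identity: with the seven atom masses summing to `1`
(`q = P(A₁A₂A₃)`, `ua = P(A₁ᶜA₃)`, `ub = P(A₂ᶜA₃)`, `uc = P(A₁A₂A₃ᶜ)`, `t = P(A₁ᶜA₂ᶜ)`, `n₁ = P(A₁ᶜA₂A₃ᶜ)`, `n₂ = P(A₁A₂ᶜA₃ᶜ)`), the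
sum of the seven expectations of the certificate (`P(A₁) = q+ub+uc+n₂`, `P(A₂) = q+ua+uc+n₁`, `P(A₁A₂) = q+uc`, `P(A₁A₃) = q+ub`) equals
`−E₃(A₁,A₂,A₃) = −(2q + P(A₁)P(A₂)P(A₃) − P(A₁)P(A₂A₃) − P(A₂)P(A₁A₃) − P(A₃)P(A₁A₂))` with `P(A₃) = q+ua+ub`, `P(A₂A₃) = q+ua`. [this work] -/
theorem hyb_identity (q ua ub uc t n₁ n₂ : ℝ) (h : q + ua + ub + uc + t + n₁ + n₂ = 1) :
    ua * (q + ub + uc + n₂) * (ub + t + n₂) + ub * (ua + t + n₁) * (q + ua + uc + n₁)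
      - q * (q + ub + uc + n₂) * (q + ua + uc + n₁) - 1 * q * (ub + t + n₂) - 1 * (ua + t + n₁) * q
      + 1 * ua * (q + uc) + 1 * (q + ub) * (q + uc) =
    -(2 * q + (q + ub + uc + n₂) * (q + ua + uc + n₁) * (q + ua + ub) -
        ((q + ub + uc + n₂) * (q + ua) + (q + ua + uc + n₁) * (q + ub) + (q + ua + ub) * (q + uc))) := by
  have ht : t = 1 - q - ua - ub - uc - n₁ - n₂ := by linarith
  subst ht
  ring

end HybridThreePointLB

end Summit.CriticalPhenomena.PercolationContinuityZ3.Theorems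

end
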